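import Literature.MathematicalPhysics.QuantumFieldTheory.Balaban1983to89.B7Eq84Concrete

/-!
# B7 Sect. C, last page: the gauge transformation `u` "expressed by the averagings `U̿₁^j`" — formulas (101)–(108),
at an arbitrary background `U₀` (`B7Eq106Concrete`)

Source: T. Bałaban, *Averaging operations for lattice gauge theories*, Commun. Math. Phys. **98** (1985) 17–51
[cite: Balaban1985Averaging], Sect. C pp. 32–33, formulas (101)–(108) (with (62) p. 28 as the case `k = 1`). Page numbers
are journal pages; every quotation below was read on the page renders (journal page = render page + 16).

## What this file is

`B7Eq84Concrete` (the parent leaf) certified the gauge fixing of Sect. C at an arbitrary background `U₀`: for `U′ = U₁^u`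
(moving frame (55)), the block axial gauge conditions (67) at the levels `j < k` together with the averaging condition
(81) at level `k` determine `u` uniquely, "given by the formulas (77) for `j = k − 1` and by (87)" (`eq77`,
`eq81_iff_eq87`, `gauge_formula`, the construction `glev`). `B7Eq92Concrete`/`B7Eq99Concrete` certified the fundamental
equality (97) `Ũ₁^j = (U̿₁^j)^{v_j}` with the accumulated frame `v_j` (`tildIter_eq_mgauge`, `vcov`) and (99)
`\overline{R_{0,x}U₁}^{(j)} = v_j(x)` (`wrec_eq_vcov`). This file certifies the LAST PAGE of Sect. C (p. 33), which combines
them. P. 32: "Let us consider again the gauge transformation u calculated before in terms of U₁ and given by the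
equalities (77) for j = k−1, (87). In the future we will need this transformation expressed by the averagings U̿^j_1. Let
us write explicitly the formula for u", and p. 33:

* (101) "R(U₀(Γ^{(k)}_{y,x}))u(x) = (\overline{R_{0,y}U₁}^{(k)})⁻¹ ∏_{j=k−1}^{0} R(Ū₀^{j+1}(Γ^{(k−j−1)}_{y,x_{j+1}}))
  ·(R̄^j_{0,x_{j+1}}Ũ^j_1)(Γ_{x_{j+1},x_j}), (101) where x ∈ B^k(y), y ∈ Ω^{(k)}, x_k = y, x_0 = x." (`eq101`: `eq77` at `m = k` +
  (87), the product written with print's relative rotations, `telProd_eq_dprod`);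
* (102) "We use the equalities (97) and we get for j > 0 (R̄^j_{0,x_{j+1}}Ũ^j_1)(Γ_{x_{j+1},x_j}) =
  v_j(x_{j+1})(R̄^j_{0,x_{j+1}}U̿^j_1)(Γ_{x_{j+1},x_j})·(R̄^j_{0,x_{j+1}}v_j)⁻¹(x_j). (102)" (`eq102`, `eq102_lv`; it holds at `j = 0`
  too, `v_0 = 1`);
* (103) "If we take two neighboring factors for j, j−1 in (101), then the last factor on the right-hand side above for
  j and the first factor for j−1 give the product (R(Ū₀^{j+1}(Γ^{(k−j−1)}_{y,x_{j+1}}))R(Ū₀^j(Γ_{x_{j+1},x_j}))v_j⁻¹(x_j))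
  (R(Ū₀^j(Γ^{(k−j)}_{y,x_j}))v_{j−1}(x_j)) = R(Ū₀^j(Γ^{(k−j)}_{y,x_j}))(v_j⁻¹(x_j)v_{j−1}(x_j)) =
  R(Ū₀^j(Γ^{(k−j)}_{y,x_j}))(\overline{R̄^{j−1}_{0,x_j}U̿^{j−1}_1})⁻¹, (103) where we have used the second Eq. (97)." (`eq103`, both
  equalities; `telUp_succ_right` is the composition of the two rotations by (57));
* (104) "We connect this expression with the factor corresponding to j−1. We get such an expression for j−1 = 0
  also. The first factor in (102) for j+1 = k and the first factor on the right-hand side of (101) give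
  v_k⁻¹(y)v_{k−1}(y) and this is equal to (103) for j = k. Thus we obtain the equality R(U₀(Γ^{(k)}_{y,x}))u(x) =
  ∏_{j=k−1}^{0} R(Ū₀^{j+1}(Γ^{(k−j−1)}_{y,x_{j+1}}))·[(\overline{R̄^j_{0,x_{j+1}}U̿^j_1})⁻¹(R̄^j_{0,x_{j+1}}U̿^j_1)(Γ_{x_{j+1},x_j})].
  (104)" (`eq104`, `eq104_dprod`; the telescoping itself is the UNCONDITIONAL identity `telTw_eq_vcov_mul_telProd`);
* (105) "Let us recall that we have (\overline{R̄^j_{0,x_{j+1}}U̿^j_1}) = exp[iΣ_{x∈B(x_{j+1})}L^{−d}(1/i)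
  log(R̄^j_{0,x_{j+1}}U̿^j_1)(Γ_{x_{j+1},x})]. (105)" (`eq105`, by `rfl` from (82) `B7Eq92Concrete.wframe`);
* (106) "The Eq. (104) can be written also in the following way: u(x) = ∏_{j=k−1}^{0} (R(U₀(Γ^{(j+1)}_{x_{j+1},x})))⁻¹
  [(\overline{R̄^j_{0,x_{j+1}}U̿^j_1})⁻¹(R̄^j_{0,x_{j+1}}U̿^j_1)(Γ_{x_{j+1},x_j})], (106)" (`eq106`; for THE gauge fixing `glev` of
  the parent leaf with no hypothesis left, `eq106_glev`);
* (107) "and this gives the formulas (\overline{R₀u})^j(x_j) = ∏_{l=k−1}^{j} (R(Ū₀^j(Γ^{(l+1−j)}_{x_{l+1},x_j})))⁻¹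
  ·[(\overline{R̄^l_{0,x_{l+1}}U̿^l_1})⁻¹(R̄^l_{0,x_{l+1}}U̿^l_1)(Γ_{x_{l+1},x_l})], (107)" (`eq107`, every `j ≤ k`; `eq107_glev`);
* (108) "(\overline{R₀u^j})⁻¹(x_{j+1})R(Ū₀^j(Γ_{x_{j+1},x_j}))(\overline{R₀u^j})(x_j) = (R̄^j_{0,x_{j+1}}U̿^j_1)(Γ_{x_{j+1},x_j}). (108)"
  (`eq108`, every `j < k`, under (67) alone; `eq108_R0fun`, `eq108_glev`);
* the case `k = 1`, Sect. B p. 28: "The equality (60) and the condition (61) imply v⁻¹(y)(R_{0,y}v)(x) =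
  (R_{0,y}V₁)(Γ_{y,x}), and v(y) = exp[−iΣ_{x∈B(y)}L^{−d}(1/i) log(R_{0,y}V₁)(Γ_{y,x})] (62)" (`eq62_transport` = (108) at
  `j = 0`, `eq62_frame` = (87) at `k = 1`);
* the flat background `U₀ = 1` ((110) p. 34: no rotations): `eq106_one_left`.

THE METHOD OF PROOF of (107)/(108) is print's "composition of averaging operations" made explicit (§3): the objects of
level `j + i` — `Ū₀^{j+i}` (43), `U̿₁^{j+i}` (91: "it is a composition of the operation (89) for V₀ = Ū₀^j and of the j-th
order operation U̿^j_1"), `Ũ₁^{j+i}` (69), `v_{j+i}` (97), `\overline{R₀u}^{j+i}` (80) — are the level-`i` objects of the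
LEVEL-`j` PROBLEM with background `Ū₀^j`, field `U̿₁^j` and gauge transformation `\overline{R₀u}^j` (`avgIter_add`,
`dbavgCovIter_add`, `tildIter_add`, `vcov_add`, `uavg_add`), and the gauge conditions (67) descend to it
(`axialGauge_shift`, via (84) `\overline{R₀u}^j = u_jv_j`, (97) and the fact that (55) is an action, `mgauge_mgauge`). Then
(107) is (106) for the level-`j` problem and (108) is its level-`0` axial gauge condition solved as in (72) ⇔ (76).

Everything is kernel-proved algebra over the unit group `𝔸ˣ` of a complex Banach algebra (§§1–2 over any monoid /
group), on the infinite lattice `ℤ^d`, block size `L ≥ 1` wherever the Euclidean block decomposition `x_m = L·x_{m+1} + r`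
is used. NO analytic input (smallness, unitarity, positivity, convergence of (21)) is used: (101)–(108) are identities
between the formal objects, under the displayed gauge conditions as hypotheses.

## Dictionary (print ↦ Lean)

As in `B7Eq84Concrete` (`U₀ U₁ : Site d → Fin d → 𝔸ˣ`, `u : Site d → 𝔸ˣ`, `Ū₀^j` ↦ `avgIter L U₀ j`, `Ũ₁^j` ↦ `tildIter L U₀ U₁ j`,
`U̿₁^j` ↦ `dbavgCovIter L U₀ U₁ j`, `v_j` (97) ↦ `vcov L U₀ U₁ j`, `\overline{R₀u}^j` (80) ↦ `uavg L U₀ u j`, `R(X)Y = XYX⁻¹` ↦ `Rc X Y`,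
`(R̄^j_{0,y}W)(Γ_{y,x})` ↦ `tHol (avgIter L U₀ j) W y (treeWord (x − y))`, the block frame (82)/(105) ↦ `wframe`, (67) at the
levels `< k` ↦ `AxialGauge L U₀ U₁ u k` (the parent leaf's `B7Eq84Concrete.AxialGauge`, the `ℤ^d`-holonomy carrier over
`𝔸ˣ` — NOT `Setup.AxialGauge` over `ContourData`), (81) ↦ `∀ z, uavg L U₀ u k z = 1`), plus, for a fine site `x` with
`x_m := (fl L)^[m] x ∈ Ω^{(m)}` (so `x_{m+1} = fl L x_m`, `x_m = L·x_{m+1} + boxVec L (brem L hL x_m) ∈ B(x_{m+1})`, `y = x_k`):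

* `∏_{j=m−1}^{0} f_j` (top factor LEFTMOST) ↦ `dprod f m` (§1);
* `Ū₀^m(Γ_{x_{m+1},x_m})` ↦ `lvHol L hL U₀ m x`; `U₀(Γ^{(m)}_{x_m,x})` ↦ `telHol L hL U₀ m x` (parent leaf);
  `Ū₀^i(Γ^{(n)}_{x_{i+n},x_i})` ↦ `telUp L hL U₀ i n x` (`= telHol` of the level-`i` problem at `x_i`);
* `(R̄^m_{0,x_{m+1}}Ũ^m_1)(Γ_{x_{m+1},x_m})` ↦ `lvTw L hL U₀ U₁ m x`; `(R̄^m_{0,x_{m+1}}U̿^m_1)(Γ_{x_{m+1},x_m})` ↦ `lvDbT L hL U₀ U₁ m x`;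
  `(\overline{R̄^m_{0,x_{m+1}}U̿^m_1})` (105) ↦ `lvFr L U₀ U₁ m x`;
* the symbol `(R_{0,x_m}U₁)(Γ^{(m)}_{x_m,x})` of (77)/(101) ↦ `telTw L hL U₀ U₁ m x` (parent leaf) `= telProd … (lvTw …) m`; the
  right-hand side of (104) ↦ `telProd L hL U₀ x (fun j => (lvFr … j x)⁻¹ * lvDbT … j x) k` (recursive form) `=` the `dprod` with
  the relative rotations `R(Ū₀^{j+1}(Γ^{(k−j−1)}_{y,x_{j+1}}))` ↦ `Rc (telUp L hL U₀ (j+1) (k−j−1) x)` (`telProd_eq_dprod`).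

## Certified here (kernel)

`eq101` (101); `eq102`, `eq102_lv` (102); `eq103` (103); `telTw_eq_vcov_mul_telProd` (the telescoping (102)–(103),
unconditional); `eq104`, `eq104_dprod`, `eq104_glev` (104); `eq105` (105); `eq106`, `eq106_glev`, `eq106_one_left` (106);
`eq107`, `eq107_glev` (107); `eq108`, `eq108_R0fun`, `eq108_glev` (108); `eq62_transport`, `eq62_frame` (62); the composition
lemmas `avgIter_add` (43), `dbavgCovIter_add` (91), `tildIter_add` (69), `vcov_add` (97), `uavg_add` (80), `axialGauge_shift`
(67 for the level-`j` problem), `mgauge_mgauge` ((55) is an action); the product algebra `telProd_eq_dprod`,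
`Rc_inv_telProd_eq_dprod`, `telHol_split`, `telUp_succ_right` ((57)).

## NOT certified here

The operator reading of print's products (the symbols `R(·)` acting on everything to their right) is notation for the
explicit conjugations formalised here (as in the parent leaf's (77)); finite periodic lattices (we work on `ℤ^d`); in (105)
print's `i·(1/i)` is dropped and `log` is the series (21) `MatrixLog.mlog`, exactly as in (82) `B7Eq92Concrete.Fcov`/`wframe`
(no convergence or unitarity claim is made or needed for the identities); Sect. D (Props. 3–7 for `Ū₁^k`, pp. 33–43) and
every ANALYTIC use of (106)/(107) (B8 (1.70) ff.) — none is used. Print's side conditions "j > 0" in (102) and "x ≠ y" in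
(67) are not needed (at `j = 0`, `v_0 = 1`; at `x = y` the condition reads `1 = 1`).

ABSOLUTE RULE: no statement of the paper enters as a cited fact; (67) and (81) appear only as HYPOTHESES (the parent
leaf's predicate `AxialGauge`, the equations `uavg … k z = 1`) or discharged for the constructed `glev` (`…_glev`). Tree API
used, by name: `B7Eq84Concrete` (`AxialGauge`, `eq77`, `eq84`, `eq81_iff_eq87`, `uavg`, `uavg_zero`, `uavg_succ`, `telHol`,
`telHol_zero`, `telTw`, `telTw_zero`, `glev`, `axialGauge_glev`, `eq81_glev`, `brem`, `fl_decomp`), `B7Eq99Concrete` (`R0fun`,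
`R0fun_apply`, `R0fun_add`, `wrec`, `wrec_one`, `wrec_eq_vcov`), `B7Eq92Concrete` (`Rc`, `Rc_mul`, `Rc_inv_apply`, `Rc_one_apply`,
`mgauge`, `mgauge_apply`, `tHol`, `tHol_mgauge`, `tHol_one_left`, `tildIter`, `tildIter_apply`, `tildIter_zero'`, `tildIter_mul`,
`tildIter_mgauge`, `tildIter_eq_mgauge`, `dbavgCovIter`, `dbavgCovIter_succ`, `dbavgCovIter_one_left`, `vcov`, `vcov_zero`,
`vcov_succ`, `wframe`, `Fcov`, `avgIter_one`), `B7Prop1Explicit` (`hol`, `treeWord`, `disp_treeWord`, `boxVec`, `expUnit`, `Site`),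
`B7Prop2Explicit` (`avgIter`, `avgIter_zero`, `avgIter_succ`), `B7Prop4Flat` (`dbavgIter`), `MatrixLog` (`mlog`),
`B7AvgGaugeCovariance` (`uLev`, `uLev_apply`, `uLev_zero`, `uLev_smul`), `B8Ineq130` (`fl`, `hol_one`).

RELATION TO `B8Ineq170` (B8 (1.70)): that leaf carries (106)/(107) SCHEMATICALLY — a descending product
`B8Ineq170.dprod`/`u106`/`avg107` of abstract unitary level factors `g_n⋆(d̄_n⋆e^{iX})g_n` in a C⋆-algebra, bounded in norm.
The present file proves that the gauge fixing `u` of Sect. C and its averages `\overline{R₀u}^j` ARE such descending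
products of the CONCRETE objects of B7 (frames `U₀(Γ^{(j+1)}_{x_{j+1},x})` resp. `Ū₀^j(Γ^{(l+1−j)}_{x_{l+1},x_j})`, block frames
(105), transports of `U̿₁^j`); `B8Ineq170.dprod F m` and `dprod F m` are the same recursion (for `F : ℕ → 𝔸`). Neither file
imports the other.

VERSIONS: v1 (this file): §1 `dprod`; §2 `mgauge_mgauge`, `uLev_add`, `uLev_mul`, `iterate_fl_shift`; §3 the composition
lemmas and `axialGauge_shift`; §4 the level symbols `lvHol`, `lvTw`, `lvDbT`, `lvFr`, `telUp`, `telProd` with their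
recursions, shifts and product expansions; §5 (101)–(105); §6 (106)–(108), (62), the flat case and first instances.
-/

noncomputable section

open NormedSpace Finset

namespace Literature.MathematicalPhysics.QuantumFieldTheory.Balaban1983to89.B7Eq106Concrete

open B7Prop1Explicit B7Prop2Explicit B7Prop3Flat B7Prop4Flat MatrixLog B7AvgGaugeCovariance B7Prop6Flat
open B7Eq92Concrete B7Eq99Concrete B7Eq84Concrete
open B8Ineq130 (fl)
open B8Eq115GaugeFixing (fl_smul fl_block)

export B7Prop1Explicit (Site)
export B7Eq84Concrete (AxialGauge)

variable {d : ℕ}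

/-! ## §1 Descending ordered products `∏_{j=m−1}^{0}` -/

section DProd

variable {M N : Type*} [Monoid M] [Monoid N]

/-- The DESCENDING ordered product `∏_{j=m−1}^{0} f j = f (m−1) · f (m−2) · … · f 0` in a (noncommutative) monoid — the
order of print's products in (77), (101), (104), (106), (107): the top-level factor on the LEFT. [folklore] -/
def dprod (f : ℕ → M) : ℕ → M
  | 0 => 1
  | m + 1 => f m * dprod f m

/-- `dprod_zero`: the empty product. [folklore] -/
@[simp] theorem dprod_zero (f : ℕ → M) : dprod f 0 = 1 := rfl

/-- `dprod_succ`: `∏_{j=m}^{0} f j = f m · ∏_{j=m−1}^{0} f j`. [folklore] -/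
theorem dprod_succ (f : ℕ → M) (m : ℕ) : dprod f (m + 1) = f m * dprod f m := rfl

/-- `dprod_one'`: `∏_{j=0}^{0} f j = f 0`. [folklore] -/
theorem dprod_one' (f : ℕ → M) : dprod f 1 = f 0 := by
  rw [dprod_succ, dprod_zero, mul_one]

/-- `dprod_congr`: the product depends only on `f 0, …, f (m−1)`. [folklore] -/
theorem dprod_congr (f g : ℕ → M) : ∀ m : ℕ, (∀ j < m, f j = g j) → dprod f m = dprod g m
  | 0, _ => rfl
  | m + 1, h => by
    rw [dprod_succ, dprod_succ, h m (Nat.lt_succ_self m),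
      dprod_congr f g m fun j hj => h j (Nat.lt_succ_of_lt hj)]

/-- `map_dprod`: a monoid homomorphism (here: a rotation `R(X)`, (56)/(57)) passes inside an ordered product. [folklore] -/
theorem map_dprod (φ : M →* N) (f : ℕ → M) : ∀ m : ℕ, φ (dprod f m) = dprod (fun j => φ (f j)) m
  | 0 => by rw [dprod_zero, dprod_zero, map_one]
  | m + 1 => by rw [dprod_succ, dprod_succ, map_mul, map_dprod φ f m]

end DProd

/-! ## §2 Group algebra: the moving-frame action (55) is an action; levels -/

section GroupAlgebra

variable {G : Type*} [Group G]

/-- The moving-frame transformation (55) is an ACTION of the gauge group: `(W^b)^a = W^{ab}` relative to the same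
background `V₀` (bondwise `a(x)[b(x)W_x,κ R_{0}b⁻¹(x+e_κ)]R_{0}a⁻¹(x+e_κ) = (ab)(x)W_{x,κ}R_{0}(ab)⁻¹(x+e_κ)`, `R` multiplicative
(56)/(57)). [cite: Balaban1985Averaging, (55)–(57) p.27] -/
theorem mgauge_mgauge (V₀ : Site d → Fin d → G) (a b : Site d → G) (W : Site d → Fin d → G) :
    mgauge V₀ a (mgauge V₀ b W) = mgauge V₀ (a * b) W := by
  funext x κ
  simp only [mgauge_apply, Pi.mul_apply, map_mul, mul_inv_rev, mul_assoc]

end GroupAlgebra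

section Levels

variable {G : Type*}

/-- `u` read `j` levels up and then `i` levels up is `u` read `j + i` levels up: `(u_j)_i = u_{j+i}` (`L^j(L^iz) = L^{j+i}z`).
[folklore] -/
theorem uLev_add (L : ℕ) (u : Site d → G) (j i : ℕ) : uLev L (uLev L u j) i = uLev L u (j + i) := by
  funext z
  simp only [uLev_apply, smul_smul, ← pow_add]

/-- Reading at level `j` is multiplicative. [folklore] -/
theorem uLev_mul [Mul G] (L : ℕ) (a b : Site d → G) (j : ℕ) : uLev L (a * b) j = uLev L a j * uLev L b j := rfl

/-- Block centres compose: the level-`i` centre above the level-`j` centre above `x` is the level-`(j+i)` centre above `x`,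
`(fl L)^[i] ((fl L)^[j] x) = (fl L)^[j+i] x`. [folklore] -/
theorem iterate_fl_shift (L : ℕ) (j i : ℕ) (x : Site d) : (fl L)^[i] ((fl L)^[j] x) = (fl L)^[j + i] x := by
  rw [← Function.iterate_add_apply, Nat.add_comm]

end Levels

/-! ## §3 "A composition of averaging operations" (p. 31, (91); p. 24, (43)): the objects at level `j + i` are the
level-`i` objects of the LEVEL-`j` PROBLEM `(Ū₀^j, U̿₁^j)` -/

section Semigroup

variable {𝔸 : Type*} [NormedRing 𝔸] [NormedAlgebra ℂ 𝔸] [CompleteSpace 𝔸]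

/-- **(43) composed**: `\overline{(Ū^j)}^{i} = Ū^{j+i}` — `i` more averaging operations (42)/(43) applied to the `j`-fold
average give the `(j+i)`-fold average (p. 24: "a sequence of averaging operations applied to a configuration U").
[cite: Balaban1985Averaging, (43) p.24] -/
theorem avgIter_add (L : ℕ) (V : Site d → Fin d → 𝔸ˣ) (j : ℕ) :
    ∀ i : ℕ, avgIter L (avgIter L V j) i = avgIter L V (j + i)
  | 0 => rfl
  | i + 1 => by
    rw [avgIter_succ L (avgIter L V j) i, avgIter_add L V j i]
    rfl

/-- **(91) composed** (p. 31: "U̿₁^{j+1} = \overline{\overline{R(Ū₀^j)U̿₁^j}}, i.e., it is a composition of the operation (89) for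
V₀ = Ū₀^j and of the j-th order operation U̿₁^j"): the `(j+i)`-th double-bar average of `U₁` at the background `U₀` is the
`i`-th double-bar average of `U̿₁^j` at the background `Ū₀^j`. [cite: Balaban1985Averaging, (91) p.31] -/
theorem dbavgCovIter_add (L : ℕ) (U₀ U₁ : Site d → Fin d → 𝔸ˣ) (j : ℕ) :
    ∀ i : ℕ, dbavgCovIter L (avgIter L U₀ j) (dbavgCovIter L U₀ U₁ j) i = dbavgCovIter L U₀ U₁ (j + i)
  | 0 => rfl
  | i + 1 => by
    funext z κ
    rw [dbavgCovIter_succ L (avgIter L U₀ j) (dbavgCovIter L U₀ U₁ j) i z κ, dbavgCovIter_add L U₀ U₁ j i,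
      avgIter_add]
    rfl

/-- **(68)/(69) composed**: `Ũ₁^{j+i}` (relative to `U₀`) is the `i`-th object (69) of `Ũ₁^j` relative to the background `Ū₀^j`
(`(\overline{U₁U₀})^{j+i} = \overline{(Ũ₁^jŪ₀^j)}^{i}` by (43) composed). [cite: Balaban1985Averaging, (68)–(69) p.29, (43) p.24] -/
theorem tildIter_add (L : ℕ) (U₀ U₁ : Site d → Fin d → 𝔸ˣ) (j i : ℕ) :
    tildIter L (avgIter L U₀ j) (tildIter L U₀ U₁ j) i = tildIter L U₀ U₁ (j + i) := by
  funext z κ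
  rw [tildIter_apply, tildIter_apply, tildIter_mul, avgIter_add, avgIter_add]

/-- **(97) composed**: the accumulated frame splits as `v_{j+i}(z) = v_j(L^iz)·v′_i(z)`, where `v′_i` is the accumulated frame (97)
of the level-`j` problem `(Ū₀^j, U̿₁^j)` — print's product (97)/(160) `v_{j+i} = w_0w_1⋯w_{j−1}·w_j⋯w_{j+i−1}` cut after `j`
factors, the later factors `\overline{R̄^{j+l}_{0,·}U̿₁^{j+l}}` being those of the level-`j` problem by (91) composed.
[cite: Balaban1985Averaging, (97) p.32, (160) p.42, (91) p.31] -/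
theorem vcov_add (L : ℕ) (U₀ U₁ : Site d → Fin d → 𝔸ˣ) (j : ℕ) :
    ∀ (i : ℕ) (z : Site d), vcov L U₀ U₁ (j + i) z
      = uLev L (vcov L U₀ U₁ j) i z * vcov L (avgIter L U₀ j) (dbavgCovIter L U₀ U₁ j) i z
  | 0, z => by simp
  | i + 1, z => by
    show vcov L U₀ U₁ (j + i + 1) z = _
    rw [vcov_succ L U₀ U₁ (j + i) z, vcov_add L U₀ U₁ j i ((L : ℤ) • z), uLev_smul,
      vcov_succ L (avgIter L U₀ j) (dbavgCovIter L U₀ U₁ j) i z, avgIter_add, dbavgCovIter_add, mul_assoc]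

/-- **(80) composed**: `\overline{R₀u}^{j+i}` is the `i`-th order average (79)/(80), at the background `Ū₀^j`, of the `j`-th
order average `\overline{R₀u}^j` ((80) is this for `i = 1`). [cite: Balaban1985Averaging, (80) p.30] -/
theorem uavg_add (L : ℕ) (U₀ : Site d → Fin d → 𝔸ˣ) (u : Site d → 𝔸ˣ) (j : ℕ) :
    ∀ i : ℕ, uavg L (avgIter L U₀ j) (uavg L U₀ u j) i = uavg L U₀ u (j + i)
  | 0 => rfl
  | i + 1 => by
    funext z
    rw [uavg_succ L (avgIter L U₀ j) (uavg L U₀ u j) i z, uavg_add L U₀ u j i, avgIter_add]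
    rfl

/-- **The gauge conditions descend to the level-`j` problem.** If `U′ = U₁^u` satisfies the block axial gauge conditions
(67) at the levels `< k` (relative to `U₀`), then for `j ≤ k` the level-`j` data — background `Ū₀^j`, field `U̿₁^j`, gauge
transformation `\overline{R₀u}^j` — satisfy (67) at the levels `< k − j`: indeed `(U̿₁^j)^{\overline{R₀u}^j} = (U̿₁^j)^{u_jv_j} =
((U̿₁^j)^{v_j})^{u_j} = (Ũ₁^j)^{u_j} = Ũ′^j` by (84)+(99) (`\overline{R₀u}^j = u_jv_j`), (55) an action, the fundamental equality
(97) and the covariance (71), and the `i`-fold objects (69) of `Ũ′^j` at `Ū₀^j` are those of `U′` at level `j + i`.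
[cite: Balaban1985Averaging, (67) p.29, (84) p.30, (97) p.32, (71) p.29] -/
theorem axialGauge_shift (L : ℕ) (U₀ U₁ : Site d → Fin d → 𝔸ˣ) (u : Site d → 𝔸ˣ) {k j : ℕ}
    (hax : AxialGauge L U₀ U₁ u k) (hj : j ≤ k) :
    AxialGauge L (avgIter L U₀ j) (dbavgCovIter L U₀ U₁ j) (uavg L U₀ u j) (k - j) := by
  intro i hi z r
  have h := hax (j + i) (by omega) z r
  rw [tildIter_mgauge, ← tildIter_add L U₀ U₁ j i, tildIter_eq_mgauge L U₀ U₁ j, tildIter_mgauge, avgIter_add,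
    mgauge_mgauge, ← uLev_add L u j i, ← uLev_mul] at h
  have e : uavg L U₀ u j = fun z => uLev L u j z * vcov L U₀ U₁ j z := by
    rw [eq84 L U₀ U₁ u hax j hj, wrec_eq_vcov]
  rw [e, tildIter_mgauge, avgIter_add]
  exact h

end Semigroup

/-! ## §4 The level symbols of (101)–(108) above a site `x` (`x_m = (fl L)^[m] x`, `x_{m+1} = fl L x_m`) -/

section LevelSymbols

variable {𝔸 : Type*} [NormedRing 𝔸] [NormedAlgebra ℂ 𝔸] [CompleteSpace 𝔸]

/-- **`Ū₀^m(Γ_{x_{m+1},x_m})`** — the background transporter of level `m` along the tree contour of the block of `x_m`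
(based at `L·x_{m+1}` in level-`m` coordinates); `telHol … (m+1) x = Ū₀^m(Γ_{x_{m+1},x_m})·U₀(Γ^{(m)}_{x_m,x})` (`telHol_succ'`).
[cite: Balaban1985Averaging, p.29 (display before (77)), (103) p.33, (108) p.33] -/
def lvHol (L : ℕ) (hL : 1 ≤ L) (U₀ : Site d → Fin d → 𝔸ˣ) (m : ℕ) (x : Site d) : 𝔸ˣ :=
  hol (avgIter L U₀ m) ((L : ℤ) • fl L ((fl L)^[m] x)) (treeWord (boxVec L (brem L hL ((fl L)^[m] x))))

/-- **`(R̄^m_{0,x_{m+1}}Ũ₁^m)(Γ_{x_{m+1},x_m})`** — the `Ū₀^m`-twisted transport (58) of `Ũ₁^m` (69) along `Γ_{x_{m+1},x_m}`: the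
level-`m` factor of (77)/(101). [cite: Balaban1985Averaging, (101)–(102) p.33, (77) p.30] -/
def lvTw (L : ℕ) (hL : 1 ≤ L) (U₀ U₁ : Site d → Fin d → 𝔸ˣ) (m : ℕ) (x : Site d) : 𝔸ˣ :=
  tHol (avgIter L U₀ m) (tildIter L U₀ U₁ m) ((L : ℤ) • fl L ((fl L)^[m] x))
    (treeWord (boxVec L (brem L hL ((fl L)^[m] x))))

/-- **`(R̄^m_{0,x_{m+1}}U̿₁^m)(Γ_{x_{m+1},x_m})`** — the `Ū₀^m`-twisted transport (58) of the double-bar average `U̿₁^m` (91)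
along `Γ_{x_{m+1},x_m}`: the level-`m` factor of (104)/(106)/(107) and the right-hand side of (108).
[cite: Balaban1985Averaging, (102) p.33, (104) p.33, (108) p.33] -/
def lvDbT (L : ℕ) (hL : 1 ≤ L) (U₀ U₁ : Site d → Fin d → 𝔸ˣ) (m : ℕ) (x : Site d) : 𝔸ˣ :=
  tHol (avgIter L U₀ m) (dbavgCovIter L U₀ U₁ m) ((L : ℤ) • fl L ((fl L)^[m] x))
    (treeWord (boxVec L (brem L hL ((fl L)^[m] x))))

/-- **`(\overline{R̄^m_{0,x_{m+1}}U̿₁^m})`** (105) — the block frame (82) of `U̿₁^m` at the background `Ū₀^m`, at the centre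
`x_{m+1}` (`B7Eq92Concrete.wframe` at `L·x_{m+1}`); by (97) `v_{m+1}(x_{m+1}) = v_m(x_{m+1})·(\overline{R̄^m_{0,x_{m+1}}U̿₁^m})`
(`B7Eq92Concrete.vcov_succ`). [cite: Balaban1985Averaging, (105) p.33, (97) p.32, (82) p.30] -/
def lvFr (L : ℕ) (U₀ U₁ : Site d → Fin d → 𝔸ˣ) (m : ℕ) (x : Site d) : 𝔸ˣ :=
  wframe L (avgIter L U₀ m) (dbavgCovIter L U₀ U₁ m) ((L : ℤ) • fl L ((fl L)^[m] x))

/-- **`Ū₀^i(Γ^{(n)}_{x_{i+n},x_i})`** — the telescoped transporter of `n` levels STARTING AT LEVEL `i` (p. 29's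
`U₀(Γ^{(j)}_{x_j,x})` for the background `Ū₀^i` and the site `x_i`): `Ū₀^{i+n−1}(Γ_{x_{i+n},x_{i+n−1}})·…·Ū₀^i(Γ_{x_{i+1},x_i})`;
in (101)/(104) `Ū₀^{j+1}(Γ^{(k−j−1)}_{y,x_{j+1}})`, in (103) `Ū₀^j(Γ^{(k−j)}_{y,x_j})`, in (107) `Ū₀^j(Γ^{(l+1−j)}_{x_{l+1},x_j})`. It IS
`telHol` of the level-`i` problem (`B7Eq84Concrete.telHol` at the background `Ū₀^i` and the site `x_i`), by (43) composed.
[cite: Balaban1985Averaging, p.29 (display before (77)), (101) p.33, (103)–(104) p.33, (107) p.33] -/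
def telUp (L : ℕ) (hL : 1 ≤ L) (U₀ : Site d → Fin d → 𝔸ˣ) (i n : ℕ) (x : Site d) : 𝔸ˣ :=
  telHol L hL (avgIter L U₀ i) n ((fl L)^[i] x)

/-- **The common shape of the products (77)/(101) and (104)**: `P₀ = 1`, `P_{m+1} = t_m · R(Ū₀^m(Γ_{x_{m+1},x_m}))[P_m]`, which
generates `∏_{j=m−1}^{0} R(Ū₀^{j+1}(Γ^{(m−j−1)}_{x_m,x_{j+1}})) t_j` (`telProd_eq_dprod`) by the multiplicativity (56)/(57) of `R`; for
`t_j = (R̄^j_{0,x_{j+1}}Ũ₁^j)(Γ_{x_{j+1},x_j})` it is the symbol `(R_{0,x_m}U₁)(Γ^{(m)}_{x_m,x})` of (77)/(101) (`B7Eq84Concrete.telTw`,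
`telTw_eq_telProd`), for `t_j = [(\overline{R̄^j_{0,x_{j+1}}U̿₁^j})⁻¹(R̄^j_{0,x_{j+1}}U̿₁^j)(Γ_{x_{j+1},x_j})]` the right-hand side of (104).
[cite: Balaban1985Averaging, (77) p.30, (101) p.33, (104) p.33] -/
def telProd (L : ℕ) (hL : 1 ≤ L) (U₀ : Site d → Fin d → 𝔸ˣ) (x : Site d) (t : ℕ → 𝔸ˣ) : ℕ → 𝔸ˣ
  | 0 => 1
  | m + 1 => t m * Rc (lvHol L hL U₀ m x) (telProd L hL U₀ x t m)

/-! ### Unfoldings and recursions -/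

/-- `telHol_succ'`: `U₀(Γ^{(m+1)}_{x_{m+1},x}) = Ū₀^m(Γ_{x_{m+1},x_m})·U₀(Γ^{(m)}_{x_m,x})`.
[cite: Balaban1985Averaging, p.29 (display before (77))] -/
theorem telHol_succ' (L : ℕ) (hL : 1 ≤ L) (U₀ : Site d → Fin d → 𝔸ˣ) (m : ℕ) (x : Site d) :
    telHol L hL U₀ (m + 1) x = lvHol L hL U₀ m x * telHol L hL U₀ m x := rfl

/-- `telTw_succ'`: the recursion of (77) in the level symbols, `T_{m+1} = (R̄^m_{0,x_{m+1}}Ũ₁^m)(Γ_{x_{m+1},x_m})·R(Ū₀^m(Γ_{x_{m+1},x_m}))[T_m]`.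
[cite: Balaban1985Averaging, (77) p.30] -/
theorem telTw_succ' (L : ℕ) (hL : 1 ≤ L) (U₀ U₁ : Site d → Fin d → 𝔸ˣ) (m : ℕ) (x : Site d) :
    telTw L hL U₀ U₁ (m + 1) x = lvTw L hL U₀ U₁ m x * Rc (lvHol L hL U₀ m x) (telTw L hL U₀ U₁ m x) := rfl

/-- `telProd_zero`. [cite: Balaban1985Averaging, (101) p.33] -/
@[simp] theorem telProd_zero (L : ℕ) (hL : 1 ≤ L) (U₀ : Site d → Fin d → 𝔸ˣ) (x : Site d) (t : ℕ → 𝔸ˣ) :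
    telProd L hL U₀ x t 0 = 1 := rfl

/-- `telProd_succ`. [cite: Balaban1985Averaging, (101) p.33] -/
theorem telProd_succ (L : ℕ) (hL : 1 ≤ L) (U₀ : Site d → Fin d → 𝔸ˣ) (x : Site d) (t : ℕ → 𝔸ˣ) (m : ℕ) :
    telProd L hL U₀ x t (m + 1) = t m * Rc (lvHol L hL U₀ m x) (telProd L hL U₀ x t m) := rfl

/-- The symbol `(R_{0,x_m}U₁)(Γ^{(m)}_{x_m,x})` of (77)/(101) is `telProd` for the factors `(R̄^j_{0,x_{j+1}}Ũ₁^j)(Γ_{x_{j+1},x_j})`.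
[cite: Balaban1985Averaging, (77) p.30, (101) p.33] -/
theorem telTw_eq_telProd (L : ℕ) (hL : 1 ≤ L) (U₀ U₁ : Site d → Fin d → 𝔸ˣ) (x : Site d) :
    ∀ m : ℕ, telTw L hL U₀ U₁ m x = telProd L hL U₀ x (fun j => lvTw L hL U₀ U₁ j x) m
  | 0 => rfl
  | m + 1 => by rw [telTw_succ', telProd_succ, telTw_eq_telProd L hL U₀ U₁ x m]

/-- `telUp_zero`: `Ū₀^i(Γ^{(0)}_{x_i,x_i}) = 1`. [cite: Balaban1985Averaging, p.29 (display before (77))] -/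
@[simp] theorem telUp_zero (L : ℕ) (hL : 1 ≤ L) (U₀ : Site d → Fin d → 𝔸ˣ) (i : ℕ) (x : Site d) :
    telUp L hL U₀ i 0 x = 1 := rfl

/-- `telUp_zero_left`: starting at level `0` it is `U₀(Γ^{(n)}_{x_n,x})` itself. [cite: Balaban1985Averaging, p.29 (display before (77))] -/
@[simp] theorem telUp_zero_left (L : ℕ) (hL : 1 ≤ L) (U₀ : Site d → Fin d → 𝔸ˣ) (n : ℕ) (x : Site d) :
    telUp L hL U₀ 0 n x = telHol L hL U₀ n x := rfl

/-! ### The level symbols of the level-`j` problem are those of the original problem, `j` levels up -/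

/-- `Ū₀^j`'s level-`i` block transporter above `x_j` is `Ū₀^{j+i}(Γ_{x_{j+i+1},x_{j+i}})`. [cite: Balaban1985Averaging, (43) p.24, p.29] -/
theorem lvHol_shift (L : ℕ) (hL : 1 ≤ L) (U₀ : Site d → Fin d → 𝔸ˣ) (j i : ℕ) (x : Site d) :
    lvHol L hL (avgIter L U₀ j) i ((fl L)^[j] x) = lvHol L hL U₀ (j + i) x := by
  simp only [lvHol, avgIter_add, iterate_fl_shift]

/-- The level-`i` factor of (101) for the level-`j` problem `(Ū₀^j, Ũ₁^j)` is the level-`(j+i)` factor of the original.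
[cite: Balaban1985Averaging, (68)–(69) p.29, (101) p.33] -/
theorem lvTw_shift (L : ℕ) (hL : 1 ≤ L) (U₀ U₁ : Site d → Fin d → 𝔸ˣ) (j i : ℕ) (x : Site d) :
    lvTw L hL (avgIter L U₀ j) (tildIter L U₀ U₁ j) i ((fl L)^[j] x) = lvTw L hL U₀ U₁ (j + i) x := by
  simp only [lvTw, avgIter_add, tildIter_add, iterate_fl_shift]

/-- The level-`i` factor `(R̄′^i_{0}U̿′^i)(Γ)` of the level-`j` problem `(Ū₀^j, U̿₁^j)` is `(R̄^{j+i}_{0,x_{j+i+1}}U̿₁^{j+i})(Γ_{x_{j+i+1},x_{j+i}})`,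
by (91) composed. [cite: Balaban1985Averaging, (91) p.31, (107) p.33] -/
theorem lvDbT_shift (L : ℕ) (hL : 1 ≤ L) (U₀ U₁ : Site d → Fin d → 𝔸ˣ) (j i : ℕ) (x : Site d) :
    lvDbT L hL (avgIter L U₀ j) (dbavgCovIter L U₀ U₁ j) i ((fl L)^[j] x) = lvDbT L hL U₀ U₁ (j + i) x := by
  simp only [lvDbT, avgIter_add, dbavgCovIter_add, iterate_fl_shift]

/-- The level-`i` frame (105) of the level-`j` problem is `(\overline{R̄^{j+i}_{0,x_{j+i+1}}U̿₁^{j+i}})`, by (91) composed.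
[cite: Balaban1985Averaging, (91) p.31, (105) p.33, (107) p.33] -/
theorem lvFr_shift (L : ℕ) (U₀ U₁ : Site d → Fin d → 𝔸ˣ) (j i : ℕ) (x : Site d) :
    lvFr L (avgIter L U₀ j) (dbavgCovIter L U₀ U₁ j) i ((fl L)^[j] x) = lvFr L U₀ U₁ (j + i) x := by
  simp only [lvFr, avgIter_add, dbavgCovIter_add, iterate_fl_shift]

/-- `telUp_succ`: `Ū₀^i(Γ^{(n+1)}_{x_{i+n+1},x_i}) = Ū₀^{i+n}(Γ_{x_{i+n+1},x_{i+n}})·Ū₀^i(Γ^{(n)}_{x_{i+n},x_i})` (one more level on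
top). [cite: Balaban1985Averaging, p.29 (display before (77))] -/
theorem telUp_succ (L : ℕ) (hL : 1 ≤ L) (U₀ : Site d → Fin d → 𝔸ˣ) (i n : ℕ) (x : Site d) :
    telUp L hL U₀ i (n + 1) x = lvHol L hL U₀ (i + n) x * telUp L hL U₀ i n x := by
  show telHol L hL (avgIter L U₀ i) (n + 1) ((fl L)^[i] x) = _
  rw [telHol_succ', lvHol_shift]
  rfl

/-- `telUp_succ_right`: `Ū₀^i(Γ^{(n+1)}_{x_{i+n+1},x_i}) = Ū₀^{i+1}(Γ^{(n)}_{x_{i+n+1},x_{i+1}})·Ū₀^i(Γ_{x_{i+1},x_i})` (the lowest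
level split off) — the identity "R(Ū₀^{j+1}(Γ^{(k−j−1)}_{y,x_{j+1}}))R(Ū₀^j(Γ_{x_{j+1},x_j})) = R(Ū₀^j(Γ^{(k−j)}_{y,x_j}))" used in
(103). [cite: Balaban1985Averaging, (103) p.33, (57) p.27] -/
theorem telUp_succ_right (L : ℕ) (hL : 1 ≤ L) (U₀ : Site d → Fin d → 𝔸ˣ) (i : ℕ) :
    ∀ (n : ℕ) (x : Site d), telUp L hL U₀ i (n + 1) x = telUp L hL U₀ (i + 1) n x * lvHol L hL U₀ i x
  | 0, x => by rw [telUp_succ, telUp_zero, telUp_zero, Nat.add_zero, mul_one, one_mul]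
  | n + 1, x => by
    have e : i + (n + 1) = i + 1 + n := by omega
    rw [telUp_succ L hL U₀ i (n + 1) x, telUp_succ_right L hL U₀ i n x, telUp_succ L hL U₀ (i + 1) n x,
      ← mul_assoc, e]

/-- `telHol_split`: `U₀(Γ^{(i+n)}_{x_{i+n},x}) = Ū₀^i(Γ^{(n)}_{x_{i+n},x_i})·U₀(Γ^{(i)}_{x_i,x})` — the telescoped product cut at
level `i`; with (57) this is "R(U₀(Γ^{(k)}_{y,x}))⁻¹R(Ū₀^{j+1}(Γ^{(k−j−1)}_{y,x_{j+1}})) = R(U₀(Γ^{(j+1)}_{x_{j+1},x}))⁻¹", the passage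
from (104) to (106). [cite: Balaban1985Averaging, (104) p.33, (106) p.33, (57) p.27] -/
theorem telHol_split (L : ℕ) (hL : 1 ≤ L) (U₀ : Site d → Fin d → 𝔸ˣ) (i : ℕ) (x : Site d) :
    ∀ n : ℕ, telHol L hL U₀ (i + n) x = telUp L hL U₀ i n x * telHol L hL U₀ i x
  | 0 => by rw [telUp_zero, one_mul, Nat.add_zero]
  | n + 1 => by
    show telHol L hL U₀ (i + n + 1) x = _
    rw [telHol_succ', telHol_split L hL U₀ i x n, telUp_succ, mul_assoc]

/-! ### The products expanded: print's `∏_{j=m−1}^{0}` with the relative rotations -/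

/-- **The product form of (77)/(101)/(104)**: `P_m = ∏_{j=m−1}^{0} R(Ū₀^{j+1}(Γ^{(m−j−1)}_{x_m,x_{j+1}})) t_j` — the recursion
`P_{m+1} = t_m·R(Ū₀^m(Γ_{x_{m+1},x_m}))[P_m]` expanded by the multiplicativity of `R` ((56): `R(X)(YZ) = R(X)Y·R(X)Z`) and (57)
`R(X)R(Y) = R(XY)`. [cite: Balaban1985Averaging, (101) p.33, (104) p.33, (77) p.30, (56)–(57) p.27] -/
theorem telProd_eq_dprod (L : ℕ) (hL : 1 ≤ L) (U₀ : Site d → Fin d → 𝔸ˣ) (x : Site d) (t : ℕ → 𝔸ˣ) :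
    ∀ m : ℕ, telProd L hL U₀ x t m = dprod (fun j => Rc (telUp L hL U₀ (j + 1) (m - j - 1) x) (t j)) m
  | 0 => rfl
  | m + 1 => by
    rw [telProd_succ, telProd_eq_dprod L hL U₀ x t m, dprod_succ]
    congr 1
    · show t m = Rc (telUp L hL U₀ (m + 1) (m + 1 - m - 1) x) (t m)
      rw [Nat.add_sub_cancel_left, Nat.sub_self, telUp_zero, Rc_one_apply]
    · rw [map_dprod]
      refine dprod_congr _ _ m fun j hj => ?_
      have e1 : m + 1 - j - 1 = (m - j - 1) + 1 := by omega
      have e2 : j + 1 + (m - j - 1) = m := by omega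
      rw [e1, telUp_succ, e2, Rc_mul, MonoidHom.comp_apply]

/-- **Conjugating back by the full transporter turns the relative rotations into the absolute ones of (106)**:
`R(U₀(Γ^{(m)}_{x_m,x}))⁻¹ P_m = ∏_{j=m−1}^{0} R(U₀(Γ^{(j+1)}_{x_{j+1},x}))⁻¹ t_j` (by `telHol_split` and (57)).
[cite: Balaban1985Averaging, (106) p.33, (57) p.27] -/
theorem Rc_inv_telProd_eq_dprod (L : ℕ) (hL : 1 ≤ L) (U₀ : Site d → Fin d → 𝔸ˣ) (x : Site d) (t : ℕ → 𝔸ˣ) :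
    ∀ m : ℕ, Rc (telHol L hL U₀ m x)⁻¹ (telProd L hL U₀ x t m)
      = dprod (fun j => Rc (telHol L hL U₀ (j + 1) x)⁻¹ (t j)) m
  | 0 => by rw [telProd_zero, map_one, dprod_zero]
  | m + 1 => by
    rw [dprod_succ, telProd_succ, map_mul, ← Rc_inv_telProd_eq_dprod L hL U₀ x t m, telHol_succ', mul_inv_rev,
      Rc_mul, MonoidHom.comp_apply, MonoidHom.comp_apply, (Rc_inv_apply _ _).1]

end LevelSymbols

/-! ## §5 Formulas (101)–(105) -/

section Eq104

variable {𝔸 : Type*} [NormedRing 𝔸] [NormedAlgebra ℂ 𝔸] [CompleteSpace 𝔸]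

/-- **(101)** p. 33: "R(U₀(Γ^{(k)}_{y,x}))u(x) = (\overline{R_{0,y}U₁}^{(k)})⁻¹ ∏_{j=k−1}^{0} R(Ū₀^{j+1}(Γ^{(k−j−1)}_{y,x_{j+1}}))
·(R̄^j_{0,x_{j+1}}Ũ^j_1)(Γ_{x_{j+1},x_j}), (101) where x ∈ B^k(y), y ∈ Ω^{(k)}, x_k = y, x_0 = x" — "the gauge transformation u
calculated before in terms of U₁ and given by the equalities (77) for j = k−1, (87)" (p. 32), under the gauge conditions
(67) at the levels `< k` and the averaging condition (81) (⇔ (87)) at level `k`; `y = x_k = (fl L)^[k] x`,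
`\overline{R_{0,y}U₁}^{(k)} = wrec … k y` (85). [cite: Balaban1985Averaging, (101) p.33, (77) p.30, (87) p.31] -/
theorem eq101 (L : ℕ) (hL : 1 ≤ L) (U₀ U₁ : Site d → Fin d → 𝔸ˣ) {u : Site d → 𝔸ˣ} {k : ℕ}
    (hax : AxialGauge L U₀ U₁ u k) (h81 : ∀ z : Site d, uavg L U₀ u k z = 1) (x : Site d) :
    Rc (telHol L hL U₀ k x) (u x)
      = (wrec L U₀ U₁ k ((fl L)^[k] x))⁻¹
        * dprod (fun j => Rc (telUp L hL U₀ (j + 1) (k - j - 1) x) (lvTw L hL U₀ U₁ j x)) k := by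
  rw [eq77 L hL U₀ U₁ u hax k le_rfl x, (eq81_iff_eq87 L U₀ U₁ u hax _).1 (h81 _), telTw_eq_telProd,
    telProd_eq_dprod]

/-- **(102)** p. 33: "We use the equalities (97) and we get for j > 0 (R̄^j_{0,x_{j+1}}Ũ^j_1)(Γ_{x_{j+1},x_j}) =
v_j(x_{j+1})(R̄^j_{0,x_{j+1}}U̿^j_1)(Γ_{x_{j+1},x_j})·(R̄^j_{0,x_{j+1}}v_j)⁻¹(x_j). (102)" — the fundamental equality (97)
`Ũ₁^j = (U̿₁^j)^{v_j}` (`B7Eq92Concrete.tildIter_eq_mgauge`) transported along a tree contour (covariance of (58),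
`tHol_mgauge`); here for every centre `y` and endpoint `x` (`Γ_{y,x} = treeWord (x − y)`), every `j ≥ 0` (at `j = 0`, `v_0 = 1`).
[cite: Balaban1985Averaging, (102) p.33, (97) p.32, (58) p.27] -/
theorem eq102 (L : ℕ) (U₀ U₁ : Site d → Fin d → 𝔸ˣ) (j : ℕ) (y x : Site d) :
    tHol (avgIter L U₀ j) (tildIter L U₀ U₁ j) y (treeWord (x - y))
      = vcov L U₀ U₁ j y * tHol (avgIter L U₀ j) (dbavgCovIter L U₀ U₁ j) y (treeWord (x - y))
          * (R0fun (avgIter L U₀ j) y (vcov L U₀ U₁ j) x)⁻¹ := by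
  rw [tildIter_eq_mgauge L U₀ U₁ j, tHol_mgauge, disp_treeWord, add_sub_cancel, R0fun_apply]

/-- **(102) for the contour `Γ_{x_{m+1},x_m}` of the telescoping** (`x_m ∈ B(x_{m+1})`, `x_m = L·x_{m+1} + r` by Euclidean division):
`(R̄^m_{0,x_{m+1}}Ũ₁^m)(Γ_{x_{m+1},x_m}) = v_m(x_{m+1})·(R̄^m_{0,x_{m+1}}U̿₁^m)(Γ_{x_{m+1},x_m})·[R(Ū₀^m(Γ_{x_{m+1},x_m}))v_m(x_m)]⁻¹`.
[cite: Balaban1985Averaging, (102) p.33] -/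
theorem eq102_lv (L : ℕ) (hL : 1 ≤ L) (U₀ U₁ : Site d → Fin d → 𝔸ˣ) (m : ℕ) (x : Site d) :
    lvTw L hL U₀ U₁ m x
      = vcov L U₀ U₁ m ((L : ℤ) • fl L ((fl L)^[m] x)) * lvDbT L hL U₀ U₁ m x
          * (Rc (lvHol L hL U₀ m x) (vcov L U₀ U₁ m ((fl L)^[m] x)))⁻¹ := by
  rw [lvTw, tildIter_eq_mgauge L U₀ U₁ m, tHol_mgauge, disp_treeWord, fl_decomp hL]
  rfl

/-- **(103)** p. 33: "If we take two neighboring factors for j, j−1 in (101), then the last factor on the right-hand side above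
for j and the first factor for j−1 give the product (R(Ū₀^{j+1}(Γ^{(k−j−1)}_{y,x_{j+1}}))R(Ū₀^j(Γ_{x_{j+1},x_j}))v_j⁻¹(x_j))
(R(Ū₀^j(Γ^{(k−j)}_{y,x_j}))v_{j−1}(x_j)) = R(Ū₀^j(Γ^{(k−j)}_{y,x_j}))(v_j⁻¹(x_j)v_{j−1}(x_j)) = R(Ū₀^j(Γ^{(k−j)}_{y,x_j}))(\overline{R̄^{j−1}_{0,x_j}U̿^{j−1}_1})⁻¹,
(103) where we have used the second Eq. (97)." Here `j = i + 1 ≥ 1`, `k − j − 1 = n` (any `n ≥ 0`), `x_j = (fl L)^[i+1] x`, and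
`v_{j−1}(x_j)` is `v_i` at the point `x_{i+1} ∈ Ω^{(i+1)} ⊂ Ω^{(i)}`, i.e. at `L·x_{i+1}` in level-`i` coordinates.
[cite: Balaban1985Averaging, (103) p.33, (97) p.32, (57) p.27] -/
theorem eq103 (L : ℕ) (hL : 1 ≤ L) (U₀ U₁ : Site d → Fin d → 𝔸ˣ) (i n : ℕ) (x : Site d) :
    Rc (telUp L hL U₀ (i + 2) n x)
          (Rc (lvHol L hL U₀ (i + 1) x) (vcov L U₀ U₁ (i + 1) ((fl L)^[i + 1] x))⁻¹)
        * Rc (telUp L hL U₀ (i + 1) (n + 1) x) (vcov L U₀ U₁ i ((L : ℤ) • (fl L)^[i + 1] x))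
      = Rc (telUp L hL U₀ (i + 1) (n + 1) x)
          ((vcov L U₀ U₁ (i + 1) ((fl L)^[i + 1] x))⁻¹ * vcov L U₀ U₁ i ((L : ℤ) • (fl L)^[i + 1] x))
    ∧ Rc (telUp L hL U₀ (i + 1) (n + 1) x)
          ((vcov L U₀ U₁ (i + 1) ((fl L)^[i + 1] x))⁻¹ * vcov L U₀ U₁ i ((L : ℤ) • (fl L)^[i + 1] x))
      = Rc (telUp L hL U₀ (i + 1) (n + 1) x) (lvFr L U₀ U₁ i x)⁻¹ := by
  have e : telUp L hL U₀ (i + 2) n x * lvHol L hL U₀ (i + 1) x = telUp L hL U₀ (i + 1) (n + 1) x :=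
    (telUp_succ_right L hL U₀ (i + 1) n x).symm
  constructor
  · rw [← MonoidHom.comp_apply (Rc _) (Rc _), ← Rc_mul, e, ← map_mul]
  · congr 1
    rw [lvFr, Function.iterate_succ_apply', vcov_succ, mul_inv_rev, inv_mul_cancel_right]

/-- **THE TELESCOPING BEHIND (104), AS AN IDENTITY OF THE FORMAL OBJECTS** (any `L ≥ 1`, any unit-valued `U₀`, `U₁`, every
level `m` and site `x`; NO gauge conditions, no smallness): the symbol `(R_{0,x_m}U₁)(Γ^{(m)}_{x_m,x})` of (77)/(101) equals
`v_m(x_m) · ∏_{j=m−1}^{0} R(Ū₀^{j+1}(Γ^{(m−j−1)}_{x_m,x_{j+1}}))[(\overline{R̄^j_{0,x_{j+1}}U̿₁^j})⁻¹(R̄^j_{0,x_{j+1}}U̿₁^j)(Γ_{x_{j+1},x_j})]` —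
print's manipulation (102)–(103): substitute (102) in each factor; the frames `v_j` of neighbouring factors telescope
to `(\overline{R̄^{j−1}_{0,x_j}U̿^{j−1}_1})⁻¹` by the second Eq. (97), leaving `v_m(x_m)` on the far left (print removes it
with (87)/(99): "The first factor in (102) for j + 1 = k and the first factor on the right-hand side of (101) give
v_k⁻¹(y)v_{k−1}(y)"). Proof by induction on `m`, each step being (102) at level `m` and `v_{m+1}(x_{m+1}) =
v_m(x_{m+1})(\overline{R̄^m_{0,x_{m+1}}U̿₁^m})`. [cite: Balaban1985Averaging, (101)–(104) p.33, (97) p.32] -/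
theorem telTw_eq_vcov_mul_telProd (L : ℕ) (hL : 1 ≤ L) (U₀ U₁ : Site d → Fin d → 𝔸ˣ) (x : Site d) :
    ∀ m : ℕ, telTw L hL U₀ U₁ m x
      = vcov L U₀ U₁ m ((fl L)^[m] x)
        * telProd L hL U₀ x (fun j => (lvFr L U₀ U₁ j x)⁻¹ * lvDbT L hL U₀ U₁ j x) m
  | 0 => by rw [telTw_zero, telProd_zero, mul_one]; rfl
  | m + 1 => by
    rw [telTw_succ', telProd_succ, eq102_lv, telTw_eq_vcov_mul_telProd L hL U₀ U₁ x m, map_mul,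
      Function.iterate_succ_apply', vcov_succ]
    simp only [lvFr, mul_assoc, inv_mul_cancel_left, mul_inv_cancel_left]

/-- **(104)** p. 33: "Thus we obtain the equality R(U₀(Γ^{(k)}_{y,x}))u(x) = ∏_{j=k−1}^{0} R(Ū₀^{j+1}(Γ^{(k−j−1)}_{y,x_{j+1}}))
·[(\overline{R̄^j_{0,x_{j+1}}U̿^j_1})⁻¹(R̄^j_{0,x_{j+1}}U̿^j_1)(Γ_{x_{j+1},x_j})]. (104)" — under the gauge conditions (67) at the levels
`< k` and the averaging condition (81) at level `k` (`y = x_k`): the gauge transformation expressed by the averagings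
`U̿₁^j` alone. From (101) (`B7Eq84Concrete.eq77` + (87)), (99) `\overline{R_{0,y}U₁}^{(k)} = v_k(y)` and the telescoping
`telTw_eq_vcov_mul_telProd`. Recursive form; the displayed product is `eq104_dprod`.
[cite: Balaban1985Averaging, (104) p.33, (99) p.32, (87) p.31] -/
theorem eq104 (L : ℕ) (hL : 1 ≤ L) (U₀ U₁ : Site d → Fin d → 𝔸ˣ) {u : Site d → 𝔸ˣ} {k : ℕ}
    (hax : AxialGauge L U₀ U₁ u k) (h81 : ∀ z : Site d, uavg L U₀ u k z = 1) (x : Site d) :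
    Rc (telHol L hL U₀ k x) (u x)
      = telProd L hL U₀ x (fun j => (lvFr L U₀ U₁ j x)⁻¹ * lvDbT L hL U₀ U₁ j x) k := by
  rw [eq77 L hL U₀ U₁ u hax k le_rfl x, (eq81_iff_eq87 L U₀ U₁ u hax _).1 (h81 _), wrec_eq_vcov,
    telTw_eq_vcov_mul_telProd, inv_mul_cancel_left]

/-- **(104) as displayed**, with the ordered product `∏_{j=k−1}^{0}` and the relative rotations
`R(Ū₀^{j+1}(Γ^{(k−j−1)}_{y,x_{j+1}}))`. [cite: Balaban1985Averaging, (104) p.33] -/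
theorem eq104_dprod (L : ℕ) (hL : 1 ≤ L) (U₀ U₁ : Site d → Fin d → 𝔸ˣ) {u : Site d → 𝔸ˣ} {k : ℕ}
    (hax : AxialGauge L U₀ U₁ u k) (h81 : ∀ z : Site d, uavg L U₀ u k z = 1) (x : Site d) :
    Rc (telHol L hL U₀ k x) (u x)
      = dprod (fun j => Rc (telUp L hL U₀ (j + 1) (k - j - 1) x)
          ((lvFr L U₀ U₁ j x)⁻¹ * lvDbT L hL U₀ U₁ j x)) k := by
  rw [eq104 L hL U₀ U₁ hax h81 x, telProd_eq_dprod]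

/-- (104) for THE gauge fixing of `B7Eq84Concrete` §4 (`glev … k 0`, which satisfies (67) and (81)), with no hypothesis left.
[cite: Balaban1985Averaging, (104) p.33, p.31 (first sentence after (87))] -/
theorem eq104_glev (L : ℕ) (hL : 1 ≤ L) (U₀ U₁ : Site d → Fin d → 𝔸ˣ) (k : ℕ) (x : Site d) :
    Rc (telHol L hL U₀ k x) (glev L hL U₀ U₁ k 0 x)
      = telProd L hL U₀ x (fun j => (lvFr L U₀ U₁ j x)⁻¹ * lvDbT L hL U₀ U₁ j x) k :=
  eq104 L hL U₀ U₁ (axialGauge_glev L hL U₀ U₁ k) (eq81_glev L hL U₀ U₁ k) x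

/-- **(105)** p. 33: "Let us recall that we have (\overline{R̄^j_{0,x_{j+1}}U̿^j_1}) = exp[iΣ_{x∈B(x_{j+1})}L^{−d}(1/i) log(R̄^j_{0,x_{j+1}}U̿^j_1)(Γ_{x_{j+1},x})].
(105)" — the definition (82) of the block frame, for `U̿₁^j` at `Ū₀^j` (`i·(1/i) = 1`; the block points are `x = L·x_{j+1} + r`,
`r ∈ [0, L)^d`, `log` = the series (21) `MatrixLog.mlog`). [cite: Balaban1985Averaging, (105) p.33, (82) p.30] -/
theorem eq105 (L : ℕ) (U₀ U₁ : Site d → Fin d → 𝔸ˣ) (j : ℕ) (x : Site d) :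
    ((lvFr L U₀ U₁ j x : 𝔸ˣ) : 𝔸)
      = exp (∑ r : Fin d → Fin L, (((L : ℝ) ^ d)⁻¹)
          • mlog ((tHol (avgIter L U₀ j) (dbavgCovIter L U₀ U₁ j) ((L : ℤ) • fl L ((fl L)^[j] x))
              (treeWord (boxVec L r)) : 𝔸ˣ) : 𝔸)) := rfl

end Eq104

/-! ## §6 Formulas (106)–(108) -/

section Eq106

variable {𝔸 : Type*} [NormedRing 𝔸] [NormedAlgebra ℂ 𝔸] [CompleteSpace 𝔸]

/-- **(106)** p. 33: "The Eq. (104) can be written also in the following way: u(x) = ∏_{j=k−1}^{0} (R(U₀(Γ^{(j+1)}_{x_{j+1},x})))⁻¹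
[(\overline{R̄^j_{0,x_{j+1}}U̿^j_1})⁻¹(R̄^j_{0,x_{j+1}}U̿^j_1)(Γ_{x_{j+1},x_j})], (106)" — under (67) at the levels `< k` and (81) at level
`k`: conjugate (104) back by `R(U₀(Γ^{(k)}_{y,x}))⁻¹` and use `U₀(Γ^{(k)}_{y,x}) = Ū₀^{j+1}(Γ^{(k−j−1)}_{y,x_{j+1}})U₀(Γ^{(j+1)}_{x_{j+1},x})`
with (57) (`Rc_inv_telProd_eq_dprod`). [cite: Balaban1985Averaging, (106) p.33, (57) p.27] -/
theorem eq106 (L : ℕ) (hL : 1 ≤ L) (U₀ U₁ : Site d → Fin d → 𝔸ˣ) {u : Site d → 𝔸ˣ} {k : ℕ}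
    (hax : AxialGauge L U₀ U₁ u k) (h81 : ∀ z : Site d, uavg L U₀ u k z = 1) (x : Site d) :
    u x = dprod (fun j => Rc (telHol L hL U₀ (j + 1) x)⁻¹
          ((lvFr L U₀ U₁ j x)⁻¹ * lvDbT L hL U₀ U₁ j x)) k := by
  rw [← (Rc_inv_apply (telHol L hL U₀ k x) (u x)).1, eq104 L hL U₀ U₁ hax h81 x, Rc_inv_telProd_eq_dprod]

/-- (106) for THE gauge fixing `glev … k 0` of `B7Eq84Concrete` §4, with no hypothesis left: an explicit formula for the
gauge fixing in terms of the background transporters and the double-bar averages `U̿₁^j`, `j < k`, only.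
[cite: Balaban1985Averaging, (106) p.33, p.31 (first sentence after (87))] -/
theorem eq106_glev (L : ℕ) (hL : 1 ≤ L) (U₀ U₁ : Site d → Fin d → 𝔸ˣ) (k : ℕ) :
    glev L hL U₀ U₁ k 0 = fun x => dprod (fun j => Rc (telHol L hL U₀ (j + 1) x)⁻¹
          ((lvFr L U₀ U₁ j x)⁻¹ * lvDbT L hL U₀ U₁ j x)) k :=
  funext fun x => eq106 L hL U₀ U₁ (axialGauge_glev L hL U₀ U₁ k) (eq81_glev L hL U₀ U₁ k) x

/-- **(107)** p. 33: "and this gives the formulas (\overline{R₀u})^j(x_j) = ∏_{l=k−1}^{j} (R(Ū₀^j(Γ^{(l+1−j)}_{x_{l+1},x_j})))⁻¹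
·[(\overline{R̄^l_{0,x_{l+1}}U̿^l_1})⁻¹(R̄^l_{0,x_{l+1}}U̿^l_1)(Γ_{x_{l+1},x_l})], (107)" — under (67) at the levels `< k` and (81) at level `k`,
for every `j ≤ k` (`l = j + i`, `i = k−1−j, …, 0`; `x_j = (fl L)^[j] x`). PROOF: (106) for the LEVEL-`j` PROBLEM — background
`Ū₀^j`, field `U̿₁^j`, gauge transformation `\overline{R₀u}^j`, `k − j` levels — which satisfies (67) (`axialGauge_shift`) and
(81) (`\overline{R₀′(\overline{R₀u}^j)}^{k−j} = \overline{R₀u}^k = 1`, (80) composed), its level-`i` symbols being the level-`(j+i)`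
symbols of the original ((43)/(91) composed). At `j = 0` this is (106). [cite: Balaban1985Averaging, (107) p.33, (106) p.33, (91) p.31] -/
theorem eq107 (L : ℕ) (hL : 1 ≤ L) (U₀ U₁ : Site d → Fin d → 𝔸ˣ) {u : Site d → 𝔸ˣ} {k : ℕ}
    (hax : AxialGauge L U₀ U₁ u k) (h81 : ∀ z : Site d, uavg L U₀ u k z = 1) {j : ℕ} (hj : j ≤ k) (x : Site d) :
    uavg L U₀ u j ((fl L)^[j] x)
      = dprod (fun i => Rc (telUp L hL U₀ j (i + 1) x)⁻¹
          ((lvFr L U₀ U₁ (j + i) x)⁻¹ * lvDbT L hL U₀ U₁ (j + i) x)) (k - j) := by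
  have h81' : ∀ z : Site d, uavg L (avgIter L U₀ j) (uavg L U₀ u j) (k - j) z = 1 := by
    intro z
    rw [uavg_add, Nat.add_sub_cancel' hj]
    exact h81 z
  rw [eq106 L hL (avgIter L U₀ j) (dbavgCovIter L U₀ U₁ j) (axialGauge_shift L U₀ U₁ u hax hj) h81'
    ((fl L)^[j] x)]
  refine dprod_congr _ _ (k - j) fun i _ => ?_
  rw [lvFr_shift, lvDbT_shift]
  rfl

/-- (107) for THE gauge fixing `glev … k 0` of `B7Eq84Concrete` §4, with no hypothesis left.
[cite: Balaban1985Averaging, (107) p.33] -/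
theorem eq107_glev (L : ℕ) (hL : 1 ≤ L) (U₀ U₁ : Site d → Fin d → 𝔸ˣ) {k j : ℕ} (hj : j ≤ k) (x : Site d) :
    uavg L U₀ (glev L hL U₀ U₁ k 0) j ((fl L)^[j] x)
      = dprod (fun i => Rc (telUp L hL U₀ j (i + 1) x)⁻¹
          ((lvFr L U₀ U₁ (j + i) x)⁻¹ * lvDbT L hL U₀ U₁ (j + i) x)) (k - j) :=
  eq107 L hL U₀ U₁ (axialGauge_glev L hL U₀ U₁ k) (eq81_glev L hL U₀ U₁ k) hj x

/-- **(108)** p. 33: "(\overline{R₀u^j})⁻¹(x_{j+1})R(Ū₀^j(Γ_{x_{j+1},x_j}))(\overline{R₀u^j})(x_j) = (R̄^j_{0,x_{j+1}}U̿^j_1)(Γ_{x_{j+1},x_j}). (108)" — under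
the gauge conditions (67) at the levels `< k`, for every `j < k`, `x_{j+1} = Lz`, `x_j = Lz + r ∈ B(x_{j+1})`: along the tree contours,
`U̿₁^j` is the RELATIVE PURE GAUGE of the averaged gauge transformation `\overline{R₀u}^j`. PROOF: the level-`0` axial gauge
condition of the level-`j` problem (`axialGauge_shift`), solved as in (72) ⇔ (76) — equivalently (84) `\overline{R₀u}^j = u_jv_j`,
(76) and (102). ((81) is not needed.) [cite: Balaban1985Averaging, (108) p.33, (76) p.29, (84) p.30, (102) p.33] -/
theorem eq108 (L : ℕ) (U₀ U₁ : Site d → Fin d → 𝔸ˣ) {u : Site d → 𝔸ˣ} {k : ℕ} (hax : AxialGauge L U₀ U₁ u k)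
    {j : ℕ} (hj : j < k) (z : Site d) (r : Fin d → Fin L) :
    (uavg L U₀ u j ((L : ℤ) • z))⁻¹
        * Rc (hol (avgIter L U₀ j) ((L : ℤ) • z) (treeWord (boxVec L r)))
            (uavg L U₀ u j ((L : ℤ) • z + boxVec L r))
      = tHol (avgIter L U₀ j) (dbavgCovIter L U₀ U₁ j) ((L : ℤ) • z) (treeWord (boxVec L r)) := by
  have h := axialGauge_shift L U₀ U₁ u hax hj.le 0 (Nat.sub_pos_of_lt hj) z r
  rw [avgIter_zero, tildIter_zero', tHol_mgauge, disp_treeWord, mul_inv_eq_one] at h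
  rw [← h, inv_mul_cancel_left]

/-- (108) with the rotated-function notation `(R̄^j_{0,x_{j+1}}\overline{R₀u}^j)(x_j)` (`B7Eq99Concrete.R0fun`).
[cite: Balaban1985Averaging, (108) p.33] -/
theorem eq108_R0fun (L : ℕ) (U₀ U₁ : Site d → Fin d → 𝔸ˣ) {u : Site d → 𝔸ˣ} {k : ℕ} (hax : AxialGauge L U₀ U₁ u k)
    {j : ℕ} (hj : j < k) (z : Site d) (r : Fin d → Fin L) :
    (uavg L U₀ u j ((L : ℤ) • z))⁻¹
        * R0fun (avgIter L U₀ j) ((L : ℤ) • z) (uavg L U₀ u j) ((L : ℤ) • z + boxVec L r)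
      = tHol (avgIter L U₀ j) (dbavgCovIter L U₀ U₁ j) ((L : ℤ) • z) (treeWord (boxVec L r)) := by
  rw [R0fun_add, eq108 L U₀ U₁ hax hj z r]

/-- (108) for THE gauge fixing `glev … k 0` of `B7Eq84Concrete` §4, with no hypothesis left. [cite: Balaban1985Averaging, (108) p.33] -/
theorem eq108_glev (L : ℕ) (hL : 1 ≤ L) (U₀ U₁ : Site d → Fin d → 𝔸ˣ) {k j : ℕ} (hj : j < k) (z : Site d)
    (r : Fin d → Fin L) :
    (uavg L U₀ (glev L hL U₀ U₁ k 0) j ((L : ℤ) • z))⁻¹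
        * Rc (hol (avgIter L U₀ j) ((L : ℤ) • z) (treeWord (boxVec L r)))
            (uavg L U₀ (glev L hL U₀ U₁ k 0) j ((L : ℤ) • z + boxVec L r))
      = tHol (avgIter L U₀ j) (dbavgCovIter L U₀ U₁ j) ((L : ℤ) • z) (treeWord (boxVec L r)) :=
  eq108 L U₀ U₁ (axialGauge_glev L hL U₀ U₁ k) hj z r

/-! ### The case `k = 1`: Sect. B's (62) p. 28 -/

/-- **(62), first equation** p. 28: "The equality (60) and the condition (61) imply v⁻¹(y)(R_{0,y}v)(x) = (R_{0,y}V₁)(Γ_{y,x})" —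
(108) at `j = 0` (`\overline{R₀u}^0 = u`, `U̿₁^0 = U₁`, `Ū₀^0 = U₀`); only the axial gauge conditions (58)/(60) (= (67) at level
`0`) are used. [cite: Balaban1985Averaging, (62) p.28, (108) p.33] -/
theorem eq62_transport (L : ℕ) (U₀ U₁ : Site d → Fin d → 𝔸ˣ) {u : Site d → 𝔸ˣ} {k : ℕ} (hax : AxialGauge L U₀ U₁ u k)
    (hk : 0 < k) (z : Site d) (r : Fin d → Fin L) :
    (u ((L : ℤ) • z))⁻¹ * R0fun U₀ ((L : ℤ) • z) u ((L : ℤ) • z + boxVec L r)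
      = tHol U₀ U₁ ((L : ℤ) • z) (treeWord (boxVec L r)) := by
  simpa using eq108_R0fun L U₀ U₁ hax hk z r

/-- **(62), second equation** p. 28: "v(y) = exp[−iΣ_{x∈B(y)}L^{−d}(1/i) log(R_{0,y}V₁)(Γ_{y,x})]" `= (\overline{R_{0,y}V₁})⁻¹` — (87) at
`k = 1` (`\overline{R_{0,y}U₁}^{(1)} = \overline{R_{0,y}U₁}`, `B7Eq99Concrete.wrec_one`), under (60) and the averaging condition (61)
(= (81) at `k = 1`). [cite: Balaban1985Averaging, (62) p.28, (87) p.31, (82) p.30] -/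
theorem eq62_frame (L : ℕ) (U₀ U₁ : Site d → Fin d → 𝔸ˣ) {u : Site d → 𝔸ˣ} (hax : AxialGauge L U₀ U₁ u 1)
    (h61 : ∀ z : Site d, uavg L U₀ u 1 z = 1) (z : Site d) :
    u ((L : ℤ) • z) = (wframe L U₀ U₁ ((L : ℤ) • z))⁻¹ := by
  have h := (eq81_iff_eq87 L U₀ U₁ u hax z).1 (h61 z)
  rw [wrec_one, uLev_apply, pow_one] at h
  exact h

/-! ### Flat reduction `U₀ = 1` and first instances -/

/-- At `U₀ = 1` every background transporter is `1`. [cite: Balaban1985Averaging, (110) p.34] -/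
@[simp] theorem lvHol_one_left (L : ℕ) (hL : 1 ≤ L) (m : ℕ) (x : Site d) :
    lvHol L hL (1 : Site d → Fin d → 𝔸ˣ) m x = 1 := by
  simp [lvHol, B8Ineq130.hol_one]

/-- At `U₀ = 1`, `U₀(Γ^{(m)}_{x_m,x}) = 1`. [cite: Balaban1985Averaging, (110) p.34] -/
@[simp] theorem telHol_one_left (L : ℕ) (hL : 1 ≤ L) : ∀ (m : ℕ) (x : Site d),
    telHol L hL (1 : Site d → Fin d → 𝔸ˣ) m x = 1
  | 0, x => rfl
  | m + 1, x => by rw [telHol_succ', lvHol_one_left, telHol_one_left L hL m x, one_mul]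

/-- At `U₀ = 1` the double-bar factor is the plain transport of the flat double-bar average `U̿^m` (`B7Prop4Flat.dbavgIter`)
along `Γ_{x_{m+1},x_m}` ((110): no rotations). [cite: Balaban1985Averaging, (110) p.34, (104) p.33] -/
theorem lvDbT_one_left (L : ℕ) (hL : 1 ≤ L) (U₁ : Site d → Fin d → 𝔸ˣ) (m : ℕ) (x : Site d) :
    lvDbT L hL (1 : Site d → Fin d → 𝔸ˣ) U₁ m x
      = hol (dbavgIter L U₁ m) ((L : ℤ) • fl L ((fl L)^[m] x)) (treeWord (boxVec L (brem L hL ((fl L)^[m] x)))) := by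
  simp [lvDbT]

/-- **(106) at `U₀ = 1`**: in the flat background the gauge fixing is the plain descending product
`u(x) = ∏_{j=k−1}^{0} [(\overline{U̿^j})(x_{j+1})⁻¹ · U̿^j(Γ_{x_{j+1},x_j})]` of the flat frames (`B7Prop3Flat.vframe` of `U̿^j`) and the
transports of the flat double-bar averages — no rotations ((110) p. 34). [cite: Balaban1985Averaging, (106) p.33, (110) p.34] -/
theorem eq106_one_left (L : ℕ) (hL : 1 ≤ L) (U₁ : Site d → Fin d → 𝔸ˣ) {u : Site d → 𝔸ˣ} {k : ℕ}
    (hax : AxialGauge L 1 U₁ u k) (h81 : ∀ z : Site d, uavg L 1 u k z = 1) (x : Site d) :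
    u x = dprod (fun j => (lvFr L 1 U₁ j x)⁻¹ * lvDbT L hL 1 U₁ j x) k := by
  rw [eq106 L hL 1 U₁ hax h81 x]
  exact dprod_congr _ _ k fun j _ => by rw [telHol_one_left, inv_one, Rc_one_apply]

/-- (106) at `k = 1`: `u(x) = R(U₀(Γ_{x₁,x}))⁻¹[(\overline{R_{0,x₁}U₁})⁻¹(R_{0,x₁}U₁)(Γ_{x₁,x})]` — (62) solved for `v(x)`, `x ∈ B(y)`.
[cite: Balaban1985Averaging, (106) p.33, (62) p.28] -/
example (L : ℕ) (hL : 1 ≤ L) (U₀ U₁ : Site d → Fin d → 𝔸ˣ) {u : Site d → 𝔸ˣ} (hax : AxialGauge L U₀ U₁ u 1)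
    (h61 : ∀ z : Site d, uavg L U₀ u 1 z = 1) (x : Site d) :
    u x = Rc (telHol L hL U₀ 1 x)⁻¹ ((lvFr L U₀ U₁ 0 x)⁻¹ * lvDbT L hL U₀ U₁ 0 x) := by
  rw [eq106 L hL U₀ U₁ hax h61 x]
  exact dprod_one' _

/-- (107) at `j = 0` is (106). [cite: Balaban1985Averaging, (106)–(107) p.33] -/
example (L : ℕ) (hL : 1 ≤ L) (U₀ U₁ : Site d → Fin d → 𝔸ˣ) {u : Site d → 𝔸ˣ} {k : ℕ}
    (hax : AxialGauge L U₀ U₁ u k) (h81 : ∀ z : Site d, uavg L U₀ u k z = 1) (x : Site d) :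
    u x = dprod (fun i => Rc (telHol L hL U₀ (i + 1) x)⁻¹
          ((lvFr L U₀ U₁ i x)⁻¹ * lvDbT L hL U₀ U₁ i x)) k := by
  simpa using eq107 L hL U₀ U₁ hax h81 (Nat.zero_le k) x

end Eq106

end Literature.MathematicalPhysics.QuantumFieldTheory.Balaban1983to89.B7Eq106Concrete
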